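import Literature.MathematicalPhysics.QuantumFieldTheory.Balaban1983to89.B9Thm312WholeMembersRegular

/-!
# `Balaban1983to89.B9Thm312WholeEntry0Regular` — [B9] Theorem 3.12 (p. 423): the (3.42)₁ SUP ENTRY of the perturbed propagator `A ∈ {G, G₁}` IN MODEL CURRENCY,
# through the REGULAR STATE — the intermediate of the row-20 S-leaf named for the N06 → N08 socket

T. Bałaban, *Propagators for lattice gauge theories in a background field*, Commun. Math. Phys. **99** (1985) 389–434 [`Balaban1985BackgroundPropagators`, "B9"],
Thm 3.12 pp. 421–423 ((3.130) p. 421, (3.138) p. 423: `G₁ = Σₙ G₀(TG₀)ⁿ`, convergent *"in all norms appearing on the left-hand sides of (3.42)–(3.47)"*), (3.42) p. 397;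
[4] = T. Bałaban, *Propagators and renormalization transformations for lattice gauge theories. II*, Commun. Math. Phys. **96** (1984) 223–250
[`Balaban1984PropagatorsII`], (2.51)–(2.56) pp. 232–233, Lemma 2.1 (2.60)–(2.61) p. 234.  statement-level bookkeeping with citation tags; proofs where landed; nothing
here is a claim about the Yang–Mills mass gap.

WHY THIS FILE (cell `pub-ymgap`, node N06 [B9], bundle F7 row 20, seat dag-n06-l g28).  The row-20 S-leaf `B9Thm312WholeLeafCompletePairMBZSL.thm312Printed_completePairMBZSL`
concludes the PRINTED predicate `B9.Thm312Printed`; on the way it derives, per member and configuration, the (3.42)₁ sup entry of `A ∈ {G, G₁}` in MODEL currency —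
`HasMajorant blk A (C·len a²·e^{−ρ d})` — from the step over the regular state class 𝔖 (`rightId` + `B9Thm312WholeMembersRegular.entry0_of_stateS`).  Node N08's
(3.24) door (dag-n08-d, `B1Eq324BenfattoClassSectEMemberPrecisionDoorRecordV4PAdjCurrentCancelLeaf`, hypothesis `hG1fam`) reads exactly that intermediate for `A := G₁`,
and it is NOT readable back from `Thm312Printed` at a member with an inner corner (dag-n08-d g45's β-range witness).  THIS FILE names it, member-uniformly, as ONE theorem:
★★ `entry0_of_stepS_resolvent` — from the step `G₀T : 𝔖 → 𝔖` (θ·e^{−δ_K d}), the producer `G₀ : 𝔠⁽⁰⁾ → 𝔖` (A₀·e^{−δ₀ d}), the sup reading `id : 𝔖 → 𝔠^{(−2)}` (C_R·e^{−r_R d}),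
the ℓ¹-domination of 𝔖 (a-priori finite majorant of the bootstrap), the inverses `G₀S₀ = 1`, `(S₀ − T)A = 1` (first resolvent form `A = G₀ + G₀TA`) and the smallness
`κ_𝔖·θ·c ≤ ½`: `HasMajorant blk A (2·κ_𝔖·C_R·A₀·c·len a²·e^{−ρ d})` for `0 ≤ ρ`, `ρ + σ ≤ min(δ₀, r_R)`, `ρ + 2σ ≤ δ_K`.  Proof = `exists_hasMaj_const_of_dom` →
`hasMaj_right_of_stepS` → `entry0_of_stateS` (all landed, by name); no estimate is added.
HONEST SCOPE.  Bookkeeping over hypothesis schemas of printed species; nothing of [B9]∕[4] asserted; no pin, no certificate edit; COUNT-NEUTRAL; N06 ∕ N08 NOT discharged; one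
finite lattice — nothing continuum ∕ OS ∕ mass gap.  NEW file; nothing landed is modified.  RELATED, NOT DUPLICATED: `B9Thm312WholeMembersRegular.entry0_of_stateS` (the
entry from a right entry ALREADY in the state — used here), `B9Thm312WholeStepRegular.hasMaj_right_of_stepS` (the right entry — used here), `B9Thm312WholeLeaf.entry0_of_step`
(the raw-state route of record, U8 species for `G₁`).
-/

namespace Literature.MathematicalPhysics.QuantumFieldTheory.Balaban1983to89.B9Thm312WholeEntry0Regular

open Literature.MathematicalPhysics.QuantumFieldTheory.Balaban1983to89
open B6RandomWalk B6RandomWalkHom B9Thm34Ext B11SectG B9SectDSup B9Thm312Whole B9Thm312WholeLeaf B9Thm312WholeClasses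
open B9Thm312WholeStepRegular B9Thm312WholeMembersRegular

noncomputable section

variable {g : B9.Geometry} {X : Type} [Fintype X] [Fintype g.Site] {R₀ : ℝ} {H₀ : Prop}

/-- ★★ **THE (3.42)₁ SUP ENTRY OF `A = G₀ + G₀TA` IN MODEL CURRENCY, THROUGH THE REGULAR STATE** (Thm 3.12 p. 423 with (3.42) p. 397): step `G₀T : 𝔖 → 𝔖` (θ, δ_K),
producer `G₀ : 𝔠⁽⁰⁾ → 𝔖` (A₀, δ₀), sup reading `id : 𝔖 → 𝔠^{(−2)}` (C_R, r_R), ℓ¹-domination of 𝔖, inverses `G₀S₀ = 1`, `(S₀ − T)A = 1`, smallness `κ_𝔖θc ≤ ½` ⟹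
`|A(a,b)| ≤ 2κ_𝔖C_RA₀c·(Lʲη)_a²·e^{−ρ d(a,b)}` blockwise (`0 ≤ ρ`, `ρ + σ ≤ δ₀`, `ρ + σ ≤ r_R`, `ρ + 2σ ≤ δ_K`).
[cite: Balaban1985BackgroundPropagators, Thm 3.12 pp.421–423 + (3.42) p.397; Balaban1984PropagatorsII, (2.52)–(2.56) pp.232–233 + Lemma 2.1 (2.61) p.234] -/
theorem entry0_of_stepS_resolvent (hG : GeoOK g) {blk : X → g.Site} {𝔖 : BlockNorm (toB6 g R₀ H₀) (X → ℝ)} {G0 S0 T A : Module.End ℝ (X → ℝ)}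
    {θ A₀ δ₀ δK CR rR ρ σ c Λ : ℝ} (hrow : RowSum (toB6 g R₀ H₀) σ c) (hc : 0 ≤ c) (hσ : 0 ≤ σ) (hθ : 0 ≤ θ) (hA₀ : 0 ≤ A₀) (hCR : 0 ≤ CR)
    (hρ : 0 ≤ ρ) (hρS : ρ + σ ≤ δ₀) (hρR : ρ + σ ≤ rR) (hρK : ρ + 2 * σ ≤ δK)
    (hK : HasMaj 𝔖 𝔖 (G0 ∘ₗ T) (fun a b => θ * Real.exp (-(δK * g.dist a b))))
    (hPG0 : HasMaj (cNorm R₀ H₀ blk hG.lenle 0) 𝔖 G0 (fun a b => A₀ * Real.exp (-(δ₀ * g.dist a b))))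
    (hRd : HasMaj 𝔖 (cNormR R₀ H₀ blk hG.lenle (-2)) LinearMap.id (fun a b => CR * Real.exp (-(rR * g.dist a b))))
    (hΛ : 0 ≤ Λ) (hdom : ∀ (y : g.Site) (F : X → ℝ), 𝔖.loc y F ≤ Λ * ∑ x : X, |F x|)
    (h0 : G0 * S0 = 1) (hinv : (S0 - T) * A = 1) (hq : 𝔖.κ * θ * c ≤ 1 / 2) :
    HasMajorant (g := toB6 g R₀ H₀) blk A (fun a b => 2 * 𝔖.κ * CR * A₀ * c * g.len a ^ 2 * Real.exp (-(ρ * g.dist a b))) := by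
  -- the first resolvent form and the bootstrap's a-priori finite majorant
  have hfix : A = G0 + G0 ∘ₗ T ∘ₗ A := fix_of_inverses h0 hinv
  obtain ⟨M₀, hM₀, hap⟩ := exists_hasMaj_const_of_dom hG blk blk 0 hΛ hdom (A ∘ₗ LinearMap.id)
  have hS : HasMaj (cNorm R₀ H₀ blk hG.lenle 0) 𝔖 (G0 ∘ₗ LinearMap.id) (fun a b => A₀ * Real.exp (-(δ₀ * g.dist a b))) := by
    rw [LinearMap.comp_id]; exact hPG0
  have hρ₁0 : 0 ≤ ρ + σ := add_nonneg hρ hσ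
  have hρ₁K : ρ + σ + σ ≤ δK := by linarith
  -- the right entry A : 𝔠⁽⁰⁾ → 𝔖 (g26 `hasMaj_right_of_stepS`)
  have h := hasMaj_right_of_stepS hG hrow hθ hA₀ hM₀ hρ₁0 hρS hρ₁K hK hS hfix hap (lt_one_of_le_half hq)
  rw [LinearMap.comp_id] at h
  have hA' : 0 ≤ 2 * A₀ := by positivity
  have h' : HasMaj (cNorm R₀ H₀ blk hG.lenle 0) 𝔖 A (fun a b => 2 * A₀ * Real.exp (-((ρ + σ) * g.dist a b))) := by
    refine h.mono fun a b => mul_le_mul_of_nonneg_right ?_ (Real.exp_nonneg _)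
    calc A₀ * (1 - 𝔖.κ * θ * c)⁻¹ ≤ A₀ * 2 := mul_le_mul_of_nonneg_left (inv_one_sub_le_two hq) hA₀
      _ = 2 * A₀ := by ring
  -- read the entry out of the state (g27 `entry0_of_stateS`)
  have hm0 := entry0_of_stateS hG hrow hc hA' hCR hρ (le_add_of_nonneg_right hσ) hρR h' hRd
  refine hasMajorant_mono (g := toB6 g R₀ H₀) blk hm0 fun a b => le_of_eq ?_
  ring

end

end Literature.MathematicalPhysics.QuantumFieldTheory.Balaban1983to89.B9Thm312WholeEntry0Regular
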